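import Literature.AlgebraicGeometry.Modules.SerreTwist
import Literature.AlgebraicGeometry.Resolution.ExceptionalDivisorProjCharts
import Literature.AlgebraicGeometry.Resolution.ProjectiveBirationalBlowupAffine
import Literature.AlgebraicGeometry.Resolution.ProjHomogeneousIdealSheaf
import Literature.AlgebraicGeometry.Resolution.BlowupPrincipalCharts
import Literature.AlgebraicGeometry.FundamentalGroup.HyperplanePencil
import HarnessLib

/-!
# The Rees embedding `Bl_J(Spec B) ↪ 𝐏ᵐ_B` read through the Serre-twist chart functions:
# `x_i / x_j = c_i / c_j` and `𝒪(1) = J · 𝒪` (the chart dictionary)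

Topic: `Literature/AlgebraicGeometry/Resolution`. PROVED, fact-free (one plumbing definition,
`reesEmbedding`, an abbreviation of Mathlib's `Proj.map` of the tree's graded presentation
`reesPresentation`). Step S6a of the F-53 route (δ) «domination + divisorial twist» (D-0154 (2) RES
inputs cell, seats res-inputs-p-9b / res-inputs-p-9c): the bridge between the tree's Serre-twist API on a
scheme over `𝐏ᵐ_B` (`Modules/SerreTwist*`: `SerreTwist.chartFun ι i j = ι^♯(x_i/x_j)` on
`Z_j = ι⁻¹D₊(x_j)`, `twistMod`, Serre's theorems A and `Ȟ¹(G(n)) = 0`) and the blowing up of an affine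
scheme along a finitely generated ideal.

THE MATHEMATICS (Hartshorne II Prop. 7.13 (a) and its proof, Liu Lemma 8.1.2 (e) / Prop. 8.1.12 (e), Stacks 0804/02NS). For generators
`c₀, …, c_m` of an ideal `J ⊆ B`, the surjective graded presentation `B[T₀, …, T_m] → B[Jt]`,
`T_l ↦ c_l t` (tree `reesPresentation`), gives a closed immersion
`ι = reesEmbedding c : Bl_J(Spec B) = Proj B[Jt] ↪ 𝐏ᵐ_B` over `Spec B` (Mathlib `Proj.map`; tree
`isClosedImmersion_projMap_of_surjective`, `projMap_reesPresentation_comp_projToSpec`). Under it the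
standard chart `Z_j = ι⁻¹ D₊(T_j)` is the blow-up chart `D₊(c_j t) = Spec B[J/c_j]`
(`Zop_reesEmbedding`), the chart function `x_i/x_j` pulls back to `c_i t / c_j t`, i.e.
**`(x_i/x_j) · c_j = c_i` on `Z_j`** (`chartFun_reesEmbedding_mul_pull` — the identity
`(c_i t)·c_j = (c_j t)·c_i` in `B[Jt]`, read in the degree-zero localisation at `c_j t` and pushed to
sections by Mathlib's `Proj.awayToSection_comp_appLE`), and on `Z_j` the exceptional ideal `J·𝒪` is
generated by the non-zero-divisor `c_j` (tree `affineBlowup.ideal_exceptionalIdeal_chartOpen`,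
`affineBlowup.pull_mem_nonZeroDivisors`, `BlowupPrincipalCharts`): so `ι^*𝒪(1) = J·𝒪_{Bl}` and the positive
Serre twists `twistMod ι G n` (`n_j = (x_{j′}/x_j)^n n_{j′}`) are the twists `G ⊗ (J𝒪)^n`.
Finally every blowing up `r : S′ → X` along `J` restricts over an affine open `U = Spec Γ(X,U)` to such
an affine blowing up (`IsBlowup.exists_chartImmersion`), which is how the dictionary is consumed on the
pieces `r⁻¹U` of route (δ).

* `reesEmbedding c` (plumbing `def`), `reesEmbedding_isClosedImmersion`,
  `reesEmbedding_comp_toSpec` (`ι ≫ (𝐏ᵐ_B → Spec B) = Bl → Spec B`);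
* `Zop_reesEmbedding` — `Z_j = D₊(c_j t)` (the tree's `affineBlowup.chartOpen (c j)`);
* `algebraMap_sections_reesEmbedding` — the `B`-algebra structure of `Γ(Bl, V)` through `ι` is the
  pull-back of functions along `Bl → Spec B` (`affineBlowup.pull`);
* `chartFun_reesEmbedding_mul_pull` — **`chartFun ι i j · c_j = c_i` on `Z_j`** (the exceptional ideal
  on `Z_j` is `(c_j)`, `c_j` a non-zero-divisor: tree `affineBlowup.ideal_exceptionalIdeal_chartOpen`,
  `affineBlowup.pull_mem_nonZeroDivisors`);
* `IsBlowup.exists_chartImmersion_span` — for `IsBlowup r J`, an affine open `U` and generators `c` of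
  `J(U)`: an open immersion `φ : Bl_{(c)}(Spec Γ(X,U)) → S′` onto `r⁻¹U`, over `U`, pulling `J𝒪_{S′}`
  back to the exceptional ideal.

What is NOT here: the module isomorphism `twistMod ι (G) n ≅ G ⊗ (J𝒪)ⁿ` itself (S6b) and Serre
vanishing on the pieces (S6c). No summit statement is proved; `GortzWedhorn2023_24_44_H2` (general) stays
PRINT. AI-written; AI review is weaker than expert review.

## References
* R. Hartshorne, *Algebraic Geometry*, GTM 52 (1977), II Prop. 7.13 (a) and its proof (p. 211: the charts of
  the blowing up and `π⁻¹𝓘·𝒪 = 𝒪(1)`), II Ex. 3.12 (a); II Prop. 5.12 (`𝒪(1)`). [Hartshorne1977]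
* Q. Liu, *Algebraic Geometry and Arithmetic Curves* (2002), Lemma 8.1.2 (e) (the chart dictionary
  `T_i/T_j ↦ f_i/f_j`, `Ã_{(t_j)} ⊆ A_{f_j}`), Prop. 8.1.12 (e) (`I·𝒪_X̃ = 𝒪_X̃(1)`). [Liu2002]
* The Stacks Project, Tags 0804, 02NS, 02OS. [StacksProject]
-/

noncomputable section

universe u

open CategoryTheory AlgebraicGeometry TopologicalSpace Opposite HomogeneousLocalization MvPolynomial
open Literature.Algebra.Homology Literature.Algebra.Homology.LaurentCech
open Literature.AlgebraicGeometry.Morphisms Literature.AlgebraicGeometry.Morphisms.ProjCech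
open Literature.AlgebraicGeometry.Modules Literature.AlgebraicGeometry.Modules.SerreTwist

attribute [local instance] MvPolynomial.gradedAlgebra
  Literature.AlgebraicGeometry.Motives.ProjBaseChange.algebraBase

namespace Literature.AlgebraicGeometry.Resolution

variable {B : Type u} [CommRing B] {m : ℕ} (c : Fin (m + 1) → B)

local notation3 "𝓘" => Ideal.span (Set.range c)
local notation3 "ℛ" => reesGrading (Ideal.span (Set.range c))
local notation3 "𝒜" => MvPolynomial.homogeneousSubmodule (Fin (m + 1)) B

/-! ## The Rees embedding `Bl_J(Spec B) ↪ 𝐏ᵐ_B` -/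

/-- **The Rees embedding** `Bl_J(Spec B) = Proj B[Jt] ⟶ 𝐏ᵐ_B = Proj B[T₀, …, T_m]`, `T_l ↦ c_l t`, for
generators `c₀, …, c_m` of `J` (Mathlib `Proj.map` of the tree's graded presentation `reesPresentation`).
Plumbing definition (an `abbrev`, so that the tree's lemmas about `Proj.map (reesPresentation c) _` apply by
`rw`/`simp`). [folklore] -/
abbrev reesEmbedding : affineBlowup (Ideal.span (Set.range c)) ⟶ PP B m :=
  Proj.map (reesPresentation c) (irrelevant_le_map_reesPresentation c)

/-- The Rees embedding is a closed immersion (the presentation is surjective; Hartshorne II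
Ex. 3.12 (a)). [cite: Hartshorne1977, II Ex. 3.12 (a)] -/
instance reesEmbedding_isClosedImmersion : IsClosedImmersion (reesEmbedding c) :=
  FundamentalGroup.isClosedImmersion_projMap_of_surjective _ _ (reesPresentation_surjective c)

/-- The Rees embedding is a morphism over `Spec B`: `ι ≫ (𝐏ᵐ_B → Spec B) = (Bl_J(Spec B) → Spec B)`,
i.e. `strZ (reesEmbedding c) = affineBlowup.π J`. [cite: Liu2002, Lemma 8.1.2 (e)] -/
theorem reesEmbedding_comp_toSpec : reesEmbedding c ≫ toSpec B m = affineBlowup.π 𝓘 :=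
  BirationalBlowup.projMap_reesPresentation_comp_projToSpec c

/-- `c_j ∈ J = (c₀, …, c_m)`. [folklore] -/
private theorem mem_span_range_self' (j : Fin (m + 1)) : c j ∈ 𝓘 :=
  Ideal.mem_span_range_self (f := c) (x := j)

/-- **The standard chart `Z_j = ι⁻¹ D₊(T_j)` of the Rees embedding is the blow-up chart `D₊(c_j t)`**
(the tree's `affineBlowup.chartOpen (c j)`, the image of `Spec B[J/c_j]`). [cite: StacksProject, Tag 0804] -/
theorem Zop_reesEmbedding (j : Fin (m + 1)) :
    Zop (reesEmbedding c) {j} =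
      (affineBlowup.chartOpen (I := 𝓘) (c j) (mem_span_range_self' c j) :
        (affineBlowup (Ideal.span (Set.range c))).Opens) := by
  change Proj.map (reesPresentation c) (irrelevant_le_map_reesPresentation c) ⁻¹ᵁ
      Proj.basicOpen 𝒜 (Xs B ({j} : Finset (Fin (m + 1)))) = _
  rw [Proj.map_preimage_basicOpen, Xs_singleton, reesPresentation_X]
  exact (affineBlowup.image_top_chartι (I := 𝓘) (c j) (mem_span_range_self' c j)).symm

/-- **The `B`-algebra structure of the sections of `Bl_J(Spec B)` through the Rees embedding is the
pull-back of functions along `Bl → Spec B`**: `algebraMap B Γ(Bl, V) a = a|_V` (`affineBlowup.pull`),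
because the Rees embedding is a morphism over `Spec B`. [cite: Liu2002, Lemma 8.1.2 (e)] -/
theorem algebraMap_sections_reesEmbedding (V : (affineBlowup (Ideal.span (Set.range c))).Opens) (a : B) :
    (algebraMap B (Sections (strZ (reesEmbedding c)) V) a : Γ(affineBlowup (Ideal.span (Set.range c)), V)) =
      affineBlowup.pull 𝓘 V a := by
  rw [Sections.algebraMap_apply]
  change (affineBlowup (Ideal.span (Set.range c))).presheaf.map (homOfLE le_top).op
      ((reesEmbedding c ≫ toSpec B m).appTop ((Scheme.ΓSpecIso (.of B)).inv a)) = _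
  rw [reesEmbedding_comp_toSpec]
  rfl

/-! ## The chart dictionary: `(x_i / x_j) · c_j = c_i` on `Z_j` -/

/-- `awayEquiv.symm` sends the constant `a ∈ B ⊆ B_{{j}}` to `a/1`. [folklore] -/
private theorem awayEquiv_symm_algebraMap (j : Fin (m + 1)) (a : B) :
    (awayEquiv B m ({j} : Finset (Fin (m + 1)))).symm (algebraMap B (Bsub B m {j}) a) =
      algebraMap B (HomogeneousLocalization.Away 𝒜 (Xs B ({j} : Finset (Fin (m + 1))))) a := by
  apply awayToL_injective {j}
  rw [awayToL_awayEquiv_symm]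
  exact (awayToL_fromZeroRingHom {j} a).symm

/-- `T_j` has degree one, as a membership for `Xs B {j} = T_j`. [folklore] -/
private theorem Xs_singleton_mem_one (j : Fin (m + 1)) :
    Xs B ({j} : Finset (Fin (m + 1))) ∈ 𝒜 1 := by
  rw [Xs_singleton]
  exact Motives.ProjectiveSpace.X_mem (R := B) j

/-- `awayEquiv.symm (x_i/x_j) = T_i / T_j` as a homogeneous fraction. [folklore] -/
private theorem awayEquiv_symm_tElB_singleton (i j : Fin (m + 1)) :
    (awayEquiv B m ({j} : Finset (Fin (m + 1)))).symm (tElB B {i} j) =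
      HomogeneousLocalization.Away.mk 𝒜 (Xs_singleton_mem_one (B := B) j) 1 (X i)
        (by rw [smul_eq_mul, mul_one]; exact Motives.ProjectiveSpace.X_mem (R := B) i) := by
  apply awayToL_injective {j}
  have hX : toL B m (X i) = xs B ({i} : Finset (Fin (m + 1))) 1 := by
    have h := toL_Xs_pow (A := B) ({i} : Finset (Fin (m + 1))) 1
    rwa [pow_one, Nat.cast_one, Xs_singleton] at h
  rw [awayToL_awayEquiv_symm, awayToL_mk, hX, Nat.cast_one]
  change tEl B ({i} : Finset (Fin (m + 1))) j = _
  rw [tEl_singleton]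

/-- **The evaluation map of the Rees embedding on the chart `Z_j` is `B_{{j}} ≅ (B[T]_{T_j})₀ →
(B[Jt]_{(c_j t)})₀ → Γ(Bl, D₊(c_j t))`** (Mathlib `Proj.awayToSection_comp_appLE`). [folklore] -/
private theorem evalRing_reesEmbedding (j : Fin (m + 1)) (x : Bsub B m ({j} : Finset (Fin (m + 1)))) :
    evalRing (reesEmbedding c) {j} x =
      (Proj.awayToSection ℛ (reesPresentation c (Xs B ({j} : Finset (Fin (m + 1)))))).hom
        (Away.map (reesPresentation c) (Xs B ({j} : Finset (Fin (m + 1))))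
          ((awayEquiv B m ({j} : Finset (Fin (m + 1)))).symm x)) := by
  rw [evalRing_apply]
  exact projMap_app_awayToSection (reesPresentation c) (irrelevant_le_map_reesPresentation c)
    (Xs_mem ({j} : Finset (Fin (m + 1)))) _

/-- The identity `(c_i t) · c_j = (c_j t) · c_i` in the Rees algebra `B[Jt] ⊆ B[t]`. [folklore] -/
private theorem reesT_mul_algebraMap_comm (i j : Fin (m + 1)) :
    reesT (c i) (mem_span_range_self' c i) * algebraMap B (reesAlgebra 𝓘) (c j) =
      reesT (c j) (mem_span_range_self' c j) * algebraMap B (reesAlgebra 𝓘) (c i) := by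
  apply Subtype.ext
  change (reesT (c i) _ : Polynomial B) * Polynomial.C (c j) =
    (reesT (c j) _ : Polynomial B) * Polynomial.C (c i)
  rw [coe_reesT, coe_reesT, Polynomial.monomial_mul_C, Polynomial.monomial_mul_C, mul_comm]

/-- **The key fraction identity in `(B[Jt]_{(c_j t)})₀`**: `(c_i t / c_j t) · (c_j / 1) = c_i / 1`
(the image of `T_i/T_j` under the presentation, times `c_j`, is `c_i`). [folklore] -/
private theorem awayMap_tEl_mul_reesAwayBase (i j : Fin (m + 1)) :
    Away.map (reesPresentation c) (Xs B ({j} : Finset (Fin (m + 1))))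
        ((awayEquiv B m ({j} : Finset (Fin (m + 1)))).symm (tElB B {i} j)) *
      reesAwayBase c (reesPresentation c (Xs B ({j} : Finset (Fin (m + 1))))) (c j) =
      reesAwayBase c (reesPresentation c (Xs B ({j} : Finset (Fin (m + 1))))) (c i) := by
  rw [awayEquiv_symm_tElB_singleton (B := B) i j, Away.map_mk]
  apply val_injective
  rw [val_mul, Away.val_mk, val_reesAwayBase, val_reesAwayBase, Localization.mk_mul,
    Localization.mk_eq_mk_iff, Localization.r_iff_exists]
  refine ⟨1, ?_⟩
  simp only [OneMemClass.coe_one, one_mul, mul_one, pow_one]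
  -- `(c_j t) · c_i = (c_i t) · c_j`, after `T_j ↦ c_j t`, `T_i ↦ c_i t`
  have hj : (reesPresentation c) (Xs B ({j} : Finset (Fin (m + 1)))) =
      reesT (c j) (mem_span_range_self' c j) := by
    rw [Xs_singleton, reesPresentation_X]
  have hi : (reesPresentation c) (X i) = reesT (c i) (mem_span_range_self' c i) :=
    reesPresentation_X c i
  rw [hj, hi]
  exact reesT_mul_algebraMap_comm c i j

/-- **THE CHART DICTIONARY: `(x_i / x_j) · c_j = c_i` on `Z_j = D₊(c_j t)`.** For the Rees embedding
`ι : Bl_J(Spec B) ↪ 𝐏ᵐ_B`, `T_l ↦ c_l t`, the Serre-twist chart function `chartFun ι i j = ι^♯(x_i/x_j)`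
(`Modules/SerreTwist`) satisfies `chartFun ι i j · c_j = c_i` in `Γ(Bl, Z_j)`, `c_l` denoting the
pulled-back functions (`affineBlowup.pull`, = `algebraMap B Γ(Bl, Z_j)` by
`algebraMap_sections_reesEmbedding`): on `Spec B[J/c_j]`, `x_i/x_j = c_i/c_j`. Hence
`ι^*𝒪(1) = J · 𝒪_{Bl}` and the twist relation `n_j = (x_{j′}/x_j)ⁿ n_{j′}` of `twistMod` is the
`(c_{j′}/c_j)ⁿ`-relation of `G ⊗ (J𝒪)ⁿ` (`ι^*𝒪(1) = J·𝒪`: Liu Prop. 8.1.12 (e), Hartshorne II Prop. 7.13 (a)).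
[cite: Liu2002, Lemma 8.1.2 (e)] [cite: Hartshorne1977, II Prop. 7.13 (a) and proof] -/
theorem chartFun_reesEmbedding_mul_pull (i j : Fin (m + 1)) :
    chartFun (reesEmbedding c) i j *
        affineBlowup.pull 𝓘 (Zop (reesEmbedding c) {j}) (c j) =
      affineBlowup.pull 𝓘 (Zop (reesEmbedding c) {j}) (c i) := by
  rw [← algebraMap_sections_reesEmbedding c (Zop (reesEmbedding c) {j}) (c j),
    ← algebraMap_sections_reesEmbedding c (Zop (reesEmbedding c) {j}) (c i)]
  rw [← evalRing_algebraMap (reesEmbedding c) {j} (Finset.singleton_nonempty j),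
    ← evalRing_algebraMap (reesEmbedding c) {j} (Finset.singleton_nonempty j)]
  change evalRing (reesEmbedding c) {j} (tElB B {i} j) *
      evalRing (reesEmbedding c) {j} (algebraMap B (Bsub B m {j}) (c j)) =
    evalRing (reesEmbedding c) {j} (algebraMap B (Bsub B m {j}) (c i))
  rw [← map_mul, evalRing_reesEmbedding, evalRing_reesEmbedding, map_mul, map_mul,
    awayEquiv_symm_algebraMap, awayEquiv_symm_algebraMap, awayMap_reesPresentation_algebraMap,
    awayMap_reesPresentation_algebraMap, awayMap_tEl_mul_reesAwayBase c i j]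

/-! ## The exceptional ideal on the charts `Z_j`

On `Z_j = affineBlowup.chartOpen (c j)` (`Zop_reesEmbedding`) the exceptional ideal `J·𝒪_{Bl}`
(`affineBlowup.exceptionalIdeal`) is generated by the pulled-back function `c_j`
(`affineBlowup.ideal_exceptionalIdeal_chartOpen`), which is a non-zero-divisor
(`affineBlowup.pull_mem_nonZeroDivisors`) — both already in the tree (`BlowupPrincipalCharts`); with
`algebraMap_sections_reesEmbedding` these read in the `B`-algebra `Sections (strZ (reesEmbedding c)) Z_j`. -/

/-! ## Reading a blowing up over an affine open through the Rees embedding -/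

/-- **A blowing up restricted over an affine open is a Rees-embedded affine blowing up.** For
`IsBlowup r J` (`r : S′ → X`), an affine open `U ⊆ X` and generators `c₀, …, c_m` of `J(U) ⊆ Γ(X, U)`,
there is an open immersion `φ : Bl_{(c)}(Spec Γ(X,U)) → S′` onto `r⁻¹U` with
`φ ≫ r = (Bl → Spec Γ(X,U)) ≫ (Spec Γ(X,U) ≅ U ⊆ X)` and `φ^*(J𝒪_{S′})` the exceptional ideal — the
tree's `IsBlowup.exists_chartImmersion` / `comap_comap_chartImmersion` with `J(U)` presented by `c`, so
that the source carries the Rees embedding `reesEmbedding c` and its chart dictionary.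
[cite: GortzWedhorn2020, Prop. 13.92] -/
theorem IsBlowup.exists_chartImmersion_span {S' X : Scheme.{u}} {r : S' ⟶ X} {J : X.IdealSheafData}
    (hr : IsBlowup r J) (U : X.affineOpens) {m : ℕ} (c : Fin (m + 1) → Γ(X, U))
    (hc : Ideal.span (Set.range c) = J.ideal U) :
    ∃ (φ : affineBlowup (Ideal.span (Set.range c)) ⟶ S') (_ : IsOpenImmersion φ),
      φ ≫ r = affineBlowup.π (Ideal.span (Set.range c)) ≫ U.2.fromSpec ∧
      φ.opensRange = r ⁻¹ᵁ (U : X.Opens) ∧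
      (J.comap r).comap φ = affineBlowup.exceptionalIdeal (Ideal.span (Set.range c)) := by
  -- substitute the presentation `J(U) = (c₀, …, c_m)` through a generalised ideal
  have key : ∀ I₀ : Ideal Γ(X, U), I₀ = J.ideal U →
      ∃ (φ : affineBlowup I₀ ⟶ S') (_ : IsOpenImmersion φ),
        φ ≫ r = affineBlowup.π I₀ ≫ U.2.fromSpec ∧ φ.opensRange = r ⁻¹ᵁ (U : X.Opens) ∧
        (J.comap r).comap φ = affineBlowup.exceptionalIdeal I₀ := by
    rintro I₀ rfl
    obtain ⟨φ, hφ, hcomp, hrange⟩ := hr.exists_chartImmersion U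
    exact ⟨φ, hφ, hcomp, hrange, comap_comap_chartImmersion φ hcomp⟩
  exact key _ hc

end Literature.AlgebraicGeometry.Resolution

end
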